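import Summits.BirchSwinnertonDyer.BirchSwinnertonDyer.Theorems.ThetaPartnerAtTwoMazurTateCongruenceAtTwoRPlusLineThreeFacts
import Summits.BirchSwinnertonDyer.BirchSwinnertonDyer.Theorems.ThetaPartnerAtTwoMazurTateCongruenceAtTwoTopOfPublishedInputs
import Summits.BirchSwinnertonDyer.BirchSwinnertonDyer.Theorems.ThetaPartnerAtTwoMazurTateCongruenceAtTwoTopOfIhara
import HarnessLib

/-!
# Crux `MazurTateCongruenceAtTwoTop` (stmt-BirchSwinnertonDyer-25797 = 21416 BY NAME) from THREE print facts + the period fact,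
# and from FOUR print facts {ES, SD, Bz, AU} — Serre 1972 dropped; the Kan⁺ twins for `ThetaLayerLambdaCongruenceAtTwo` (RTT 20688)

Width seat `bsd-wall-tp2-p1-w4` g0 (`--supports stmt-BirchSwinnertonDyer-25797`; THEOREMS ONLY; BSD is not proved by this). The K1 crux was
closed GRANTED PRINT ONLY by the row (`mazurTateCongruenceAtTwoTop_of_fiveFacts` = PUB⁵ {ES, SD, Bz, Se, AU}, `…TopOfPublishedInputs`;
`…_of_fourFacts_periodTwo` = PUB⁴ + the period fact). This file removes the binder `Se = serre1972_supersingular_decompositionSubgroup_image`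
from every one of these closers, using the Serre-free plus line `plusLineCharTwo_of_threeFacts` (`…RPlusLineThreeFacts`: Dokchitser–Dokchitser
surjectivity mod `2` + `Δ_min ≡ 5 (mod 8)` replace Serre's Prop. 12 at `p = 2`):

* §1 K1: `mazurTateCongruenceAtTwoTop_of_threeFacts_periodTwo_depletedUnitNegDisc / _depletionPrimitiveNegDisc / _ihara` (the lead's §6 chain of
  `…RDepletionPrimitive` and `…TopOfIhara` re-threaded), **`mazurTateCongruenceAtTwoTop_of_threeFacts_periodTwo`** (PUB³ {ES, SD, Bz} + the period
  fact `realPeriodRat_eq_unit_mul_plusPeriod_two`, via the landed (IH₂⁻) `stub_iharaSymbolModTwoNegDisc` and (DP₂⁻) `stub_depletionPrimitiveNegDisc_of_ihara`),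
  **`mazurTateCongruenceAtTwoTop_of_esSdBzAu`** (PUB⁴ {ES, SD, Bz, AU}; so `PublishedInputsHeckeAtTwo` (item 27435) implies the crux with its
  Serre conjunct unused: `mazurTateCongruenceAtTwoTop_of_esSdBzAu h.1 h.2.1 h.2.2.1 h.2.2.2.2`), the `MazurTateCongruenceAtTwoR` twins, and Greenberg–Vatsal
  `μ`-invariance at `2` on the theta habitat from PUB³ + the period fact (`muInvarianceAtTwo_of_threeFacts_periodTwo`).
* §2 Kan⁺: `thetaLayerLambdaCongruenceAtTwo_of_threeFacts_flatMuZeroAtTwo`, `…_of_esSdBzAu_signedMuAnalytic`,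
  `…_of_threeFacts_periodUnit_signedMuAnalytic`, `kanP4_of_pub_of_signedMuAnalyticAtTwoPlus` (the `…NoMazurKenku` §4 closers minus `Se`).

Nothing is asserted about the named facts; BSD is not proved by any of this.

References: Dokchitser–Dokchitser, Math. Z. 272 (2012) Thm. (1); Buzzard, MRL 7 (2000) Prop. 2.4; Greenberg–Vatsal, Invent. Math. 142 (2000)
Thm. (1.4), §3 (13); Ribet, Proc. ICM 1983 Thm. 4.3; Abbes–Ullmo, Compositio 103 (1996) Thm. A; Pollack, Duke 118 (2003) Prop. 6.18.
-/

-- justification: the `Summit.BirchSwinnertonDyer.BirchSwinnertonDyer.…` path repeats a component (route-file convention)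
set_option linter.dupNamespace false
set_option autoImplicit false

noncomputable section

open scoped Classical MatrixGroups ModularForm

open CongruenceSubgroup Polynomial WeierstrassCurve NumberField IsDedekindDomain
  Literature.NumberTheory.IwasawaTheory Literature.NumberTheory.EllipticCurves Literature.NumberTheory.EllipticCurves.ModularForms
  Literature.NumberTheory.EllipticCurves.Rank1Residual Literature.NumberTheory.EllipticCurves.GreenbergVatsal2000
  Literature.NumberTheory.EllipticCurves.Sprung2017
  Summit.BirchSwinnertonDyer.Rank1Residual.Supersingular
  Summit.BirchSwinnertonDyer.BirchSwinnertonDyer.Theorems.ThetaLayerLambdaCongruenceAtTwo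

/-! ## §1 K1 `MazurTateCongruenceAtTwoTop` BY NAME without Serre 1972 -/

namespace Summit.BirchSwinnertonDyer.BirchSwinnertonDyer.Theorems.MazurTateCongruenceAtTwoR

/-- **`MazurTateCongruenceAtTwoTop` BY NAME from PUB³ {ES, SD, Bz} + the period fact + (DU₂⁻)** — the lead's
`mazurTateCongruenceAtTwoTop_of_fourFacts_depletedUnitNegDisc` with the four-fact plus line replaced by `plusLineCharTwo_of_threeFacts`
(pointwise through `mazurTateCongruence_of_plusLine`; both curves of a theta pair have `Δ < 0`). BSD is not proved by this.
[cite: GreenbergVatsal2000, Thm. (1.4), §3 (13)] [cite: Buzzard2000LevelLoweringModTwo, Prop. 2.4] -/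
theorem mazurTateCongruenceAtTwoTop_of_threeFacts_periodTwo_depletedUnitNegDisc
    (hES : eichlerShimura_depletedOptimalQuotient_periodLattice_of_dvd) (hSD : heckeSelfDual_torsionBy_J0)
    (hBz : buzzard2000_multiplicityOne_gamma0) (h2 : realPeriodRat_eq_unit_mul_plusPeriod_two)
    (hDU : ∀ (E : WeierstrassCurve ℚ) [E.IsElliptic] [E.IsGloballyMinimal], GoodSS E 2 → E.frobeniusTrace 2 = 0 → E.Δ < 0 →
      ∀ [NeZero (E.conductorNorm ℤ)] (f : CuspForm (Gamma0 (E.conductorNorm ℤ)) 2), IsNewformOf E f →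
      ∀ (ϖ : ℚ), (ϖ : ℝ) * E.realPeriodRat = plusPeriod f →
      ∀ (S₀ : Finset (HeightOneSpectrum (𝓞 ℚ))), (∀ v ∈ S₀, ((2 : ℕ) : 𝓞 ℚ) ∉ v.asIdeal) →
        (∀ v : HeightOneSpectrum (𝓞 ℚ), ¬ E.HasGoodReductionAt v → v ∈ S₀) →
      ∃ x₀ : ℚ, ‖algebraMap ℚ (PadicAlgCl 2) (2 * ϖ) * (∑ k ∈ Fintype.piFinset (fun _ : S₀ ↦ Finset.range 3), (∏ v : S₀, ((E.localPolynomialAt (v : HeightOneSpectrum (𝓞 ℚ))).map (Int.castRingHom (PadicAlgCl 2))).coeff (k v) * ((Rat.HeightOneSpectrum.natGenerator (v : HeightOneSpectrum (𝓞 ℚ)) : PadicAlgCl 2)⁻¹) ^ (k v)) * algebraMap ℚ (PadicAlgCl 2) (ratPlusSymbol f (x₀ * ((∏ v : S₀, Rat.HeightOneSpectrum.natGenerator (v : HeightOneSpectrum (𝓞 ℚ)) ^ (k v) : ℕ) : ℚ))))‖ = 1) :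
    Summit.BirchSwinnertonDyer.BirchSwinnertonDyer.Theses.ThetaPartnerAtTwo.MazurTateCongruenceAtTwoTop := by
  intro W _ _ A _ _ _ _ hss ha hAcm hAss hAa he γ _ _ f hf ϖ hϖ Lplus Lminus hPP _ fA hfA ϖA hϖA LplusA LminusA hPPA
    S₀ hS2 hSW hSA G m hG GA m' hGA
  have hΔ : W.Δ < 0 := by
    obtain ⟨e, he'⟩ := he
    exact ThetaPartnerXRoute.Δ_neg_of_cmPartner_two W A hAcm hAss e he'
  have hΔA : A.Δ < 0 := ThetaPartnerXRoute.Δ_neg_of_hasCM_of_goodSS_two A hAcm hAss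
  exact mazurTateCongruence_of_plusLine W A (plusLineAtTwoLevel_of_charTwoLevel (plusLineCharTwo_of_threeFacts hES hSD hBz))
    hss hΔ hAss he f hf ϖ hPP fA hfA ϖA hPPA S₀ hS2 hSW hSA
    (symbolMu_of_exists_depletedUnit W h2 hss ha hf hϖ S₀ hS2 (hDU W hss ha hΔ f hf ϖ hϖ S₀ hS2 hSW))
    (symbolMu_of_exists_depletedUnit A h2 hAss hAa hfA hϖA S₀ hS2 (hDU A hAss hAa hΔA fA hfA ϖA hϖA S₀ hS2 hSA)) hG hGA

/-- **`MazurTateCongruenceAtTwoTop` BY NAME from PUB³ + the period fact + (DP₂⁻) «depletion preserves primitivity, for `Δ < 0`»** (the lead's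
`…_of_fourFacts_depletionPrimitiveNegDisc` minus `Se`). BSD is not proved by this. [cite: Ribet1984ICM, Thm. 4.3]
[cite: GreenbergVatsal2000, §3 (13) and Remark 3.4] -/
theorem mazurTateCongruenceAtTwoTop_of_threeFacts_periodTwo_depletionPrimitiveNegDisc
    (hES : eichlerShimura_depletedOptimalQuotient_periodLattice_of_dvd) (hSD : heckeSelfDual_torsionBy_J0)
    (hBz : buzzard2000_multiplicityOne_gamma0) (h2 : realPeriodRat_eq_unit_mul_plusPeriod_two)
    (hDP : ∀ (E : WeierstrassCurve ℚ) [E.IsElliptic] [E.IsGloballyMinimal], GoodSS E 2 → E.frobeniusTrace 2 = 0 → E.Δ < 0 →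
      ∀ [NeZero (E.conductorNorm ℤ)] (f : CuspForm (Gamma0 (E.conductorNorm ℤ)) 2), IsNewformOf E f →
      ∀ (ϖ : ℚ), (ϖ : ℝ) * E.realPeriodRat = plusPeriod f →
      ∀ (S₀ : Finset (HeightOneSpectrum (𝓞 ℚ))), (∀ v ∈ S₀, ((2 : ℕ) : 𝓞 ℚ) ∉ v.asIdeal) →
        (∀ v : HeightOneSpectrum (𝓞 ℚ), ¬ E.HasGoodReductionAt v → v ∈ S₀) →
      (∃ r : ℚ, ‖algebraMap ℚ (PadicAlgCl 2) (2 * ϖ) * algebraMap ℚ (PadicAlgCl 2) (ratPlusSymbol f r)‖ = 1) →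
      ∃ x₀ : ℚ, ‖algebraMap ℚ (PadicAlgCl 2) (2 * ϖ) * (∑ k ∈ Fintype.piFinset (fun _ : S₀ ↦ Finset.range 3), (∏ v : S₀, ((E.localPolynomialAt (v : HeightOneSpectrum (𝓞 ℚ))).map (Int.castRingHom (PadicAlgCl 2))).coeff (k v) * ((Rat.HeightOneSpectrum.natGenerator (v : HeightOneSpectrum (𝓞 ℚ)) : PadicAlgCl 2)⁻¹) ^ (k v)) * algebraMap ℚ (PadicAlgCl 2) (ratPlusSymbol f (x₀ * ((∏ v : S₀, Rat.HeightOneSpectrum.natGenerator (v : HeightOneSpectrum (𝓞 ℚ)) ^ (k v) : ℕ) : ℚ))))‖ = 1) :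
    Summit.BirchSwinnertonDyer.BirchSwinnertonDyer.Theses.ThetaPartnerAtTwo.MazurTateCongruenceAtTwoTop := by
  refine mazurTateCongruenceAtTwoTop_of_threeFacts_periodTwo_depletedUnitNegDisc hES hSD hBz h2 ?_
  intro E _ _ hss ha hΔ _ f hf ϖ hϖ S₀ hS2 hSE
  exact hDP E hss ha hΔ f hf ϖ hϖ S₀ hS2 hSE (exists_undepletedUnit E h2 hss hf hϖ)

/-- **`MazurTateCongruenceAtTwoTop` BY NAME from PUB³ + the period fact + (IH₂⁻) «Ihara's lemma mod `2` in symbol form»** (the lead's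
`…_of_fourFacts_ihara` minus `Se`). BSD is not proved by this. [cite: Ribet1984ICM, Thm. 4.1 and Thm. 4.3] [cite: GreenbergVatsal2000, §3 (13)] -/
theorem mazurTateCongruenceAtTwoTop_of_threeFacts_periodTwo_ihara
    (hES : eichlerShimura_depletedOptimalQuotient_periodLattice_of_dvd) (hSD : heckeSelfDual_torsionBy_J0)
    (hBz : buzzard2000_multiplicityOne_gamma0) (h2 : realPeriodRat_eq_unit_mul_plusPeriod_two)
    (hIH : ∀ (W : WeierstrassCurve ℚ) [W.IsElliptic] [W.IsGloballyMinimal], GoodSS W 2 → W.Δ < 0 → ∀ (N' : ℕ), Odd N' →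
      (∀ v : IsDedekindDomain.HeightOneSpectrum (NumberField.RingOfIntegers ℚ), ¬ ((Rat.HeightOneSpectrum.primesEquiv v : ℕ) ∣ 2 * N') → W.HasGoodReductionAt v) →
      ∀ (ℓ : ℕ), ℓ.Prime → ℓ ≠ 2 → ∀ (Φ : ℚ → PadicAlgCl 2),
      (∀ (r : ℚ) (z : ℤ), Φ (r + z) = Φ r) → (∀ r : ℚ, Φ (-r) = Φ r) → (∀ (γ : CongruenceSubgroup.Gamma0 (N')) (r : ℚ), ((γ : SL(2, ℤ)) 1 0 : ℚ) * r + ((γ : SL(2, ℤ)) 1 1 : ℚ) ≠ 0 → Φ ((((γ : SL(2, ℤ)) 0 0 : ℚ) * r + ((γ : SL(2, ℤ)) 0 1 : ℚ)) / (((γ : SL(2, ℤ)) 1 0 : ℚ) * r + ((γ : SL(2, ℤ)) 1 1 : ℚ))) = (if ((γ : SL(2, ℤ)) 1 0) = 0 then 0 else Φ ((((γ : SL(2, ℤ)) 0 0 : ℚ)) / (((γ : SL(2, ℤ)) 1 0 : ℚ)))) + Φ r) →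
      (∀ r : ℚ, ‖Φ r‖ ≤ 1) →
      (∀ q : ℕ, q.Prime → ¬ q ∣ 2 * N' * ℓ → ∀ r : ℚ, ‖(∑ j : Fin q, Φ ((r + j) / q)) + Φ (q * r) - (W.LFunction q : PadicAlgCl 2) * Φ r‖ < 1) →
      (∀ (r : ℚ) (j : ℤ) (n : ℕ), ‖Φ (r + j / (ℓ : ℚ) ^ n) - Φ r‖ < 1) →
      ∀ r : ℚ, ‖Φ r‖ < 1) :
    Summit.BirchSwinnertonDyer.BirchSwinnertonDyer.Theses.ThetaPartnerAtTwo.MazurTateCongruenceAtTwoTop :=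
  mazurTateCongruenceAtTwoTop_of_threeFacts_periodTwo_depletionPrimitiveNegDisc hES hSD hBz h2 (stub_depletionPrimitiveNegDisc_of_ihara h2 hIH)

/-- **THE CRUX BY NAME FROM PUB³ {ES, SD, Bz} + THE PERIOD FACT AT `2`, nothing else** — (IH₂⁻) is the landed theorem
`stub_iharaSymbolModTwoNegDisc`, (DP₂⁻) the landed `stub_depletionPrimitiveNegDisc_of_ihara`, the plus line is Serre-free. BSD is not proved by
this. [cite: GreenbergVatsal2000, Thm. (1.4) and §3 (13)] [cite: Ribet1984ICM, Thm. 4.3] [cite: DokchitserDokchitserMathZ2012, Theorem (1)] -/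
theorem mazurTateCongruenceAtTwoTop_of_threeFacts_periodTwo
    (hES : eichlerShimura_depletedOptimalQuotient_periodLattice_of_dvd) (hSD : heckeSelfDual_torsionBy_J0)
    (hBz : buzzard2000_multiplicityOne_gamma0) (h2 : realPeriodRat_eq_unit_mul_plusPeriod_two) :
    Summit.BirchSwinnertonDyer.BirchSwinnertonDyer.Theses.ThetaPartnerAtTwo.MazurTateCongruenceAtTwoTop :=
  mazurTateCongruenceAtTwoTop_of_threeFacts_periodTwo_ihara hES hSD hBz h2 stub_iharaSymbolModTwoNegDisc

/-- **PUB⁴ form {ES, SD, Bz, AU}**: the crux BY NAME from Eichler–Shimura (depleted optimal quotient), Hecke self-duality, Buzzard 2000 and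
Abbes–Ullmo Thm. A (the period fact at `2` from `SkinnerUrban2014.realPeriodRat_eq_unit_mul_plusPeriod_two_fact_of_abbesUllmo`) — the route's
PUB⁵ bundle `PublishedInputsHeckeAtTwo` minus Serre 1972. BSD is not proved by this. [cite: AbbesUllmo1996, Thm. A]
[cite: GreenbergVatsal2000, Thm. (1.4) and §3 (13)] -/
theorem mazurTateCongruenceAtTwoTop_of_esSdBzAu
    (hES : eichlerShimura_depletedOptimalQuotient_periodLattice_of_dvd) (hSD : heckeSelfDual_torsionBy_J0)
    (hBz : buzzard2000_multiplicityOne_gamma0) (hAU : abbesUllmo_not_dvd_maninConstant_of_not_dvd_level) :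
    Summit.BirchSwinnertonDyer.BirchSwinnertonDyer.Theses.ThetaPartnerAtTwo.MazurTateCongruenceAtTwoTop :=
  mazurTateCongruenceAtTwoTop_of_threeFacts_periodTwo hES hSD hBz
    (SkinnerUrban2014.realPeriodRat_eq_unit_mul_plusPeriod_two_fact_of_abbesUllmo hAU)

/-- The twin `MazurTateCongruenceAtTwoR` (item 21416) BY NAME from PUB³ + the period fact. [cite: GreenbergVatsal2000, §3 (13)] -/
theorem mazurTateCongruenceAtTwoR_of_threeFacts_periodTwo
    (hES : eichlerShimura_depletedOptimalQuotient_periodLattice_of_dvd) (hSD : heckeSelfDual_torsionBy_J0)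
    (hBz : buzzard2000_multiplicityOne_gamma0) (h2 : realPeriodRat_eq_unit_mul_plusPeriod_two) :
    Summit.BirchSwinnertonDyer.BirchSwinnertonDyer.Theses.ThetaPartnerAtTwo.MazurTateCongruenceAtTwoR :=
  mazurTateCongruenceAtTwoTop_of_threeFacts_periodTwo hES hSD hBz h2

/-- The twin `MazurTateCongruenceAtTwoR` (item 21416) BY NAME from PUB⁴ {ES, SD, Bz, AU}. [cite: AbbesUllmo1996, Thm. A]
[cite: GreenbergVatsal2000, §3 (13)] -/
theorem mazurTateCongruenceAtTwoR_of_esSdBzAu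
    (hES : eichlerShimura_depletedOptimalQuotient_periodLattice_of_dvd) (hSD : heckeSelfDual_torsionBy_J0)
    (hBz : buzzard2000_multiplicityOne_gamma0) (hAU : abbesUllmo_not_dvd_maninConstant_of_not_dvd_level) :
    Summit.BirchSwinnertonDyer.BirchSwinnertonDyer.Theses.ThetaPartnerAtTwo.MazurTateCongruenceAtTwoR :=
  mazurTateCongruenceAtTwoTop_of_esSdBzAu hES hSD hBz hAU

/-- **Greenberg–Vatsal `μ`-invariance at `2` on the theta habitat from PUB³ + the period fact** (the lead's `muInvarianceAtTwo_of_fourFacts_ihara`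
with `Se` dropped and (IH₂⁻) discharged by `stub_iharaSymbolModTwoNegDisc`): for every theta pair, newforms and Pollack pairs at `2`, `L♭_W` has a
unit coefficient iff `L♭_A` does. BSD is not proved by this. [cite: GreenbergVatsal2000, Thm. (1.4) and §3 (13)] [cite: Vatsal1999, Thm. (1.10)] -/
theorem muInvarianceAtTwo_of_threeFacts_periodTwo
    (hES : eichlerShimura_depletedOptimalQuotient_periodLattice_of_dvd) (hSD : heckeSelfDual_torsionBy_J0)
    (hBz : buzzard2000_multiplicityOne_gamma0) (h2 : realPeriodRat_eq_unit_mul_plusPeriod_two) :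
    ∀ (W : WeierstrassCurve ℚ) [W.IsElliptic] [W.IsGloballyMinimal] (A : WeierstrassCurve ℚ) [A.IsElliptic]
      [A.IsGloballyMinimal], ¬ W.HasCM → W.analyticRank = 0 → GoodSS W 2 → W.frobeniusTrace 2 = 0 → A.HasCM → GoodSS A 2 →
      A.frobeniusTrace 2 = 0 →
      (∃ e : geomTorsion W (2 : ℤ) ≃+ geomTorsion A (2 : ℤ),
        ∀ (σ : Field.absoluteGaloisGroup ℚ) (P : geomTorsion W (2 : ℤ)), e (σ • P) = σ • e P) →
      ∀ [NeZero (W.conductorNorm ℤ)] (f : CuspForm (Gamma0 (W.conductorNorm ℤ)) 2), IsNewformOf W f →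
      ∀ (Lplus Lminus : IwasawaAlgebra 2), IsPollackPair f 2 Lplus Lminus →
      ∀ [NeZero (A.conductorNorm ℤ)] (fA : CuspForm (Gamma0 (A.conductorNorm ℤ)) 2), IsNewformOf A fA →
      ∀ (LplusA LminusA : IwasawaAlgebra 2), IsPollackPair fA 2 LplusA LminusA →
      ((∃ n : ℕ, IsUnit (PowerSeries.coeff n (kobayashiL 1 Lplus Lminus))) ↔
        (∃ n : ℕ, IsUnit (PowerSeries.coeff n (kobayashiL 1 LplusA LminusA)))) :=
  flatIff_of_mazurTateCongruenceAtTwoTop h2 (mazurTateCongruenceAtTwoTop_of_threeFacts_periodTwo hES hSD hBz h2)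

end Summit.BirchSwinnertonDyer.BirchSwinnertonDyer.Theorems.MazurTateCongruenceAtTwoR

/-! ## §2 Kan⁺ `ThetaLayerLambdaCongruenceAtTwo` (RTT stmt-20688) BY NAME without Serre 1972 -/

namespace Summit.BirchSwinnertonDyer.BirchSwinnertonDyer.Theorems.ThetaLayerLambdaCongruenceAtTwo

open Summit.BirchSwinnertonDyer.BirchSwinnertonDyer.Theses.ResidualThetaTransportAtTwo

/-- **Kan⁺ `ThetaLayerLambdaCongruenceAtTwo` BY NAME from THREE print facts {ES, SD, Bz} + Kμ⁺'s FLAT** (`…NoMazurKenku`'s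
`…_of_fourFacts_flatMuZeroAtTwo` with the Serre-free plus line). BSD is not proved by this. [cite: GreenbergVatsal2000, §1 (10) and Prop. (2.4) (shape)]
[cite: Pollack2003, Conj. 6.3] -/
theorem thetaLayerLambdaCongruenceAtTwo_of_threeFacts_flatMuZeroAtTwo
    (hES : eichlerShimura_depletedOptimalQuotient_periodLattice_of_dvd)
    (hSD : heckeSelfDual_torsionBy_J0) (hBz : buzzard2000_multiplicityOne_gamma0)
    (hflat : ∀ (W : WeierstrassCurve ℚ) [W.IsElliptic] [W.IsGloballyMinimal], ¬ W.HasCM → W.analyticRank = 0 → Literature.NumberTheory.EllipticCurves.Rank1Residual.GoodSS W 2 → W.frobeniusTrace 2 = 0 → W.Δ < 0 → ∀ [NeZero (W.conductorNorm ℤ)] (f : CuspForm (CongruenceSubgroup.Gamma0 (W.conductorNorm ℤ)) 2), Literature.NumberTheory.EllipticCurves.ModularForms.IsNewformOf W f → ∀ (Lplus Lminus : Literature.NumberTheory.EllipticCurves.IwasawaAlgebra 2), Summit.BirchSwinnertonDyer.Rank1Residual.Supersingular.IsPollackPair f 2 Lplus Lminus → ¬ PowerSeries.C (2 : ℤ_[2])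 ∣ Lminus) :
    ThetaLayerLambdaCongruenceAtTwo :=
  thetaLayerLambdaCongruenceAtTwo_of_plusLineLevel_curveMax_nonRoot
    (plusLineAtTwoLevel_of_charTwoLevel (plusLineCharTwo_of_threeFacts hES hSD hBz))
    (stub_curveDepletedSymbolMaxAtTwoPowerCusp_of_flatMuZeroAtTwo hflat) partnerEulerFactorNonRoot

/-- **Kan⁺ BY NAME from FOUR print facts {ES, SD, Bz, AU} + the route item 21437 `SignedMuAnalyticAtTwoPlus`** (`…_of_fiveFacts_abbesUllmo_signedMuAnalytic`
minus `Se`). Conditional on four print facts and an OPEN item; BSD is not proved by this. [cite: AbbesUllmo1996, Thm. A] [cite: Pollack2003, Prop. 6.18 (shape)] -/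
theorem thetaLayerLambdaCongruenceAtTwo_of_esSdBzAu_signedMuAnalytic
    (hES : eichlerShimura_depletedOptimalQuotient_periodLattice_of_dvd)
    (hSD : heckeSelfDual_torsionBy_J0) (hBz : buzzard2000_multiplicityOne_gamma0)
    (hAU : abbesUllmo_not_dvd_maninConstant_of_not_dvd_level)
    (hμ : SignedMuAnalyticAtTwoPlus) :
    ThetaLayerLambdaCongruenceAtTwo :=
  thetaLayerLambdaCongruenceAtTwo_of_threeFacts_flatMuZeroAtTwo hES hSD hBz
    ((Summit.BirchSwinnertonDyer.BirchSwinnertonDyer.Theorems.signedMuAnalyticAtTwoPlus_iff_flatMuZero_of_abbesUllmo hAU).mp hμ)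

/-- **Abbes–Ullmo-free form**: Kan⁺ BY NAME from THREE print facts, the period-unit statement PER at `2` (inline hypothesis) and the route item
21437 (`…_of_fourFacts_periodUnit_signedMuAnalytic` minus `Se`). BSD is not proved by this. [cite: Pollack2003, Prop. 6.18 (shape)] -/
theorem thetaLayerLambdaCongruenceAtTwo_of_threeFacts_periodUnit_signedMuAnalytic
    (hES : eichlerShimura_depletedOptimalQuotient_periodLattice_of_dvd)
    (hSD : heckeSelfDual_torsionBy_J0) (hBz : buzzard2000_multiplicityOne_gamma0)
    (hper : ∀ (W : WeierstrassCurve ℚ) [W.IsElliptic] [W.IsGloballyMinimal],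
      Literature.NumberTheory.EllipticCurves.Rank1Residual.GoodSS W 2 →
      ∀ [NeZero (W.conductorNorm ℤ)] (f : CuspForm (Gamma0 (W.conductorNorm ℤ)) 2), IsNewformOf W f →
      ∃ u : ℚ, ‖(u : ℚ_[2])‖ = 1 ∧ W.realPeriodRat = u * plusPeriod f)
    (hμ : SignedMuAnalyticAtTwoPlus) :
    ThetaLayerLambdaCongruenceAtTwo :=
  thetaLayerLambdaCongruenceAtTwo_of_threeFacts_flatMuZeroAtTwo hES hSD hBz
    (Summit.BirchSwinnertonDyer.BirchSwinnertonDyer.Theorems.flatMuZero_of_signedMuAnalyticAtTwoPlus_of_periodUnit hμ hper)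

/-- **Curried form for a route binder list** («KanP» with FOUR print binders): Eichler–Shimura, Hecke self-duality, Buzzard, Abbes–Ullmo, then the
item 21437, then the crux — all BY NAME; Serre 1972 is no longer a binder. -/
theorem kanP4_of_pub_of_signedMuAnalyticAtTwoPlus :
    eichlerShimura_depletedOptimalQuotient_periodLattice_of_dvd → heckeSelfDual_torsionBy_J0 →
    buzzard2000_multiplicityOne_gamma0 → abbesUllmo_not_dvd_maninConstant_of_not_dvd_level →
    SignedMuAnalyticAtTwoPlus → ThetaLayerLambdaCongruenceAtTwo :=
  thetaLayerLambdaCongruenceAtTwo_of_esSdBzAu_signedMuAnalytic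

end Summit.BirchSwinnertonDyer.BirchSwinnertonDyer.Theorems.ThetaLayerLambdaCongruenceAtTwo

end
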